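import Literature.NumberTheory.Automorphic.GL2SphericalOfLFactorDegreeTwo
import HarnessLib

/-!
# Vanishing of the `GL₂ × GL₁` `L`-factor under ramified and under deep character twists
# (Jacquet–Langlands 1970, Props. 3.5, 3.6, 3.8 (i)), and the degree bound `deg L(s, π) ≤ 2`

Topic `Literature/NumberTheory/Automorphic`; proof file (theorems only: no definition, no named
fact, no instance).  Let `F` be a non-archimedean local field, `π` a smooth representation of
`GL₂(F)` on `V` with Jacquet module `V_N = V ⧸ V(N)` (`N` the unipotent radical of the upper Borel,
`(restrictUnipotentGL F id π).Coinvariants`), `ψ ≠ 1` a continuous additive character, `χ : Fˣ → ℂˣ`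
a smooth character and `π ⊗ χ = π ⊗ (χ ∘ det)` the twist (`Representation.twist π c` with
`c = χ ∘ det`).  The `L`-factor is the Jacquet–Piatetski-Shapiro–Shalika one,
`L(s, (π ⊗ χ) × 1) = 1 / P(q^{-s})` in the sense of `HasRSLFactor` (for `GL₂ × GL₁` this is the
Jacquet–Langlands `L`-factor `L(s, χ ⊗ π)` of LNM 114, Thm. 2.18: the same Mellin transforms of
Kirillov / Whittaker functions on the torus).  We prove, classification-free:

* `hasRSLFactor_twist_eq_one_of_jacquetGL_eq_self` — **the criterion**: if a unit `u₀` with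
  `χ(u₀) ≠ 1` acts trivially on `V_N` through `d(u₀, 1)`, then every `L`-polynomial `P` of
  `(π ⊗ χ) × 1` is `1`.  Indeed the class in `V_N` of a vector fixed by `d(𝒪ˣ, 1)` under `π ⊗ χ`
  is a `χ⁻¹(u₀)`-eigenvector of `d(u₀, 1)`, hence `0` (`mk_eq_zero_of_mem_fixedPoints_twist`;
  twisting by `χ ∘ det` does not change the restriction to `N`, `restrictUnipotentGL_twist_det`),
  so the pole bound `deg P ≤ dim (image of the d(𝒪ˣ,1)-fixed vectors in V_N)`
  (`natDegree_le_finrank_of_hasRSLFactor`, Jacquet–Langlands Props. 2.9–2.10 read backwards)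
  gives `deg P = 0`, i.e. `P = 1`.
* `exists_unitFiltration_forall_hasRSLFactor_twist_eq_one` — **deep twists kill the `L`-factor**
  (Jacquet–Langlands 1970, Prop. 3.8 (i): "if the order [= conductor exponent, p. 33] of `χ` is
  large enough, `L(s, χ ⊗ π) = 1`"): for `V_N` finite-dimensional there is `N ≥ 1` such that
  `P = 1` for every smooth `χ` non-trivial on `U^N = 1 + 𝔭^N` — because `d(U^N, 1)` acts
  trivially on the finite-dimensional smooth `V_N`
  (`exists_unitFiltration_forall_jacquetGL_diagGL2_eq_self`).
* `hasRSLFactor_twist_eq_one_of_spherical` — **a ramified twist of a spherical representation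
  has trivial `L`-factor** (Jacquet–Langlands 1970, Prop. 3.5: `L(s, χ ⊗ π(μ₁, μ₂)) =
  L(s, χμ₁) L(s, χμ₂) = 1` for `μᵢ` unramified and `χ` ramified; here read off without the
  classification): for `π` irreducible with a non-zero `GL₂(𝒪)`-fixed vector `v₀`, all of
  `d(𝒪ˣ, 1)` acts trivially on `V_N` (`jacquetGL_diagGL2_eq_self_of_spherical`: by the Iwasawa
  decomposition `V_N` is spanned by the classes of `π(b) v₀`, `b ∈ B(F)`, on which the commutative
  torus acts through `π(b)`, and `d(u, 1) v₀ = v₀`), so the criterion applies to any `χ`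
  non-trivial on `𝒪ˣ`.
* `natDegree_le_two_of_hasRSLFactor` — **`deg L(s, π × 1)⁻¹ ≤ 2`** for every irreducible smooth
  `π` (Jacquet–Langlands 1970, Thm. 2.18 with Props. 3.5–3.6 and p. 40): `dim V_N ≤ 2`
  (`finiteDimensional_coinvariants_smoothIrrep_fin_two`: either `V_N = 0`, or Frobenius
  reciprocity embeds `π` in a principal series `I(σ)` with `dim I(σ)_N ≤ 2` and the Jacquet
  functor is exact — Steps A–B of `GL2SphericalOfLFactorDegreeTwo`).

All statements produce the invariant measure `ν` on `GL₁(F) ⧸ U₁ = Fˣ` of the pole bound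
(transported Haar measure); the `L`-polynomial for it is unique (`HasRSLFactor.unique`).

These are the local inputs (R)/(N)/(deg) of the standard `L`-function theory of cuspidal `GL₂`
(`JacquetLanglands1970_twistedHeckeTheoryGL2`, clauses "`P u = 1` under ramified / deep twists"
and "`deg ≤ 2`").

## References

* H. Jacquet, R. P. Langlands, *Automorphic forms on GL(2)*, LNM 114 (1970): Thm. 2.18, Props.
  2.9–2.10, Props. 3.5, 3.6, Prop. 3.8 (i) (p. 53; "order" = conductor exponent, p. 33).
  [JacquetLanglands1970]
* R. Godement, *Notes on Jacquet–Langlands' theory*, IAS (1970), §1.3, §1.9–1.11.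
* H. Jacquet, I. I. Piatetski-Shapiro, J. Shalika, *Rankin–Selberg convolutions*, Amer. J. Math.
  105 (1983), Thm. 2.7 (ii). [JacquetPiatetskiShapiroShalika1983]
* D. Bump, *Automorphic forms and representations* (1997), §4.7, Prop. 4.5.2. [Bump1997]
-/

noncomputable section

open scoped MatrixGroups NNReal
open MeasureTheory ValuativeRel Polynomial Filter
  Literature.NumberTheory.GaloisRepresentations.IsNonarchimedeanLocalField

namespace Literature.NumberTheory.Automorphic

/-! ### Part 1: twisting by a character of the determinant -/

section DetTwist

variable {F : Type*} [Field F] {V : Type*} [AddCommGroup V] [Module ℂ V]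
  (π : Representation ℂ (GL (Fin 2) F) V)

/-- Elements of the unipotent radical of the Borel of `GL₂` have determinant `1`. [folklore] -/
theorem det_coe_unipotentRadicalP_fin_two (u : ↥(unipotentRadicalP F (id : Fin 2 → Fin 2))) :
    Matrix.GeneralLinearGroup.det
      (((u : ↥(standardParabolicGL F (id : Fin 2 → Fin 2))) : GL (Fin 2) F)) = 1 := by
  obtain ⟨x, hx⟩ := exists_coe_eq_unipotentGL2 u
  rw [hx]
  exact det_eq_one_of_mem_upperUnitriangular (unipotentGL2 x).2

/-- `det d(a, 1) = a`. [folklore] -/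
theorem det_diagGL2_one_eq (a : Fˣ) :
    Matrix.GeneralLinearGroup.det (diagGL2 a 1 : GL (Fin 2) F) = a := by
  ext
  rw [Matrix.GeneralLinearGroup.val_det_apply, coe_diagGL2, Matrix.det_fin_two_of]
  simp

/-- **Twisting by a character of the determinant does not change the restriction to the
unipotent radical** (`det = 1` there), so `π` and `π ⊗ (χ ∘ det)` have the same Jacquet module
as a vector space. (Bushnell–Henniart 2006, §9.1.) [folklore] -/
theorem restrictUnipotentGL_twist_det (χ : Fˣ →* ℂˣ) (c : GL (Fin 2) F →* ℂˣ)
    (hc : ∀ g, c g = χ (Matrix.GeneralLinearGroup.det g)) :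
    Representation.restrictUnipotentGL F (id : Fin 2 → Fin 2) (π.twist c) =
      Representation.restrictUnipotentGL F (id : Fin 2 → Fin 2) π := by
  refine MonoidHom.ext fun u => ?_
  change (π.twist c) (((u : ↥(standardParabolicGL F (id : Fin 2 → Fin 2))) : GL (Fin 2) F)) =
    π (((u : ↥(standardParabolicGL F (id : Fin 2 → Fin 2))) : GL (Fin 2) F))
  refine LinearMap.ext fun v => ?_
  rw [Representation.twist_apply, hc, det_coe_unipotentRadicalP_fin_two, map_one, Units.val_one,
    one_smul]

end DetTwist

/-! ### Part 2: the vanishing criterion -/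

section Criterion

variable {F : Type*} [Field F] [ValuativeRel F] [TopologicalSpace F] [IsNonarchimedeanLocalField F]
  {V : Type*} [AddCommGroup V] [Module ℂ V] (π : Representation ℂ (GL (Fin 2) F) V)

omit [TopologicalSpace F] [IsNonarchimedeanLocalField F] in
/-- **The class of a `d(𝒪ˣ, 1)`-fixed vector of `π ⊗ χ` dies in the Jacquet module** as soon as
some unit `u₀` with `χ(u₀) ≠ 1` acts trivially on `V_N` through `d(u₀, 1)`: the class is a
`χ(u₀)⁻¹`-eigenvector of `d(u₀, 1)`. [folklore] -/
theorem mk_eq_zero_of_mem_fixedPoints_twist {χ : Fˣ →* ℂˣ} {c : GL (Fin 2) F →* ℂˣ}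
    (hc : ∀ g, c g = χ (Matrix.GeneralLinearGroup.det g))
    (H : Subgroup (GL (Fin 2) F))
    (hH : ∀ g : GL (Fin 2) F, g ∈ H ↔ ∃ u : Fˣ, valuation F (u : F) = 1 ∧ g = diagGL2 u 1)
    {u₀ : Fˣ} (hu₀ : valuation F (u₀ : F) = 1) (hχ : χ u₀ ≠ 1)
    (htriv : ∀ x : (Representation.restrictUnipotentGL F (id : Fin 2 → Fin 2) π).Coinvariants,
      Representation.jacquetGL F (id : Fin 2 → Fin 2) π
        (leviProjection F (id : Fin 2 → Fin 2)
          ⟨diagGL2 u₀ 1, diagGL2_mem_standardParabolicGL_fin_two u₀ 1⟩) x = x)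
    {v : V} (hv : v ∈ (π.twist c).fixedPoints H) :
    Representation.Coinvariants.mk
      (Representation.restrictUnipotentGL F (id : Fin 2 → Fin 2) (π.twist c)) v = 0 := by
  set J := Representation.Coinvariants.mk (Representation.restrictUnipotentGL F (id : Fin 2 → Fin 2) π)
    with hJ
  -- `χ(u₀) π(d(u₀,1)) v = v`
  have h1 : (π.twist c) (diagGL2 u₀ 1) v = v :=
    ((π.twist c).mem_fixedPoints H v).1 hv _ ((hH _).2 ⟨u₀, hu₀, rfl⟩)
  rw [Representation.twist_apply, hc, det_diagGL2_one_eq] at h1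
  -- `J (π(d(u₀,1)) v) = J v` since `d(u₀, 1)` acts trivially on `V_N`
  have h2 : J (π (diagGL2 u₀ 1) v) = J v := by
    rw [hJ, ← jacquetGL_leviProjection_diagGL2_mk]
    exact htriv _
  -- hence `J v = χ(u₀) J v`, so `J v = 0`
  have h3 : J v = ((χ u₀ : ℂˣ) : ℂ) • J v := by
    conv_lhs => rw [← h1]
    rw [map_smul, h2]
  have h4 : J v = 0 := by
    have h5 : (((χ u₀ : ℂˣ) : ℂ) - 1) • J v = 0 := by
      rw [sub_smul, one_smul, ← h3, sub_self]
    rcases smul_eq_zero.1 h5 with h | h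
    · exact absurd (Units.val_eq_one.1 (sub_eq_zero.1 h)) hχ
    · exact h
  rw [Representation.Coinvariants.mk_eq_zero, restrictUnipotentGL_twist_det π χ c hc]
  exact (Representation.Coinvariants.mk_eq_zero _).1 h4

/-- The determinant `GL_n(F) → Fˣ` is continuous.  DUPLICATE (dedup-02566) of Mathlib's
`Matrix.GeneralLinearGroup.continuous_det`; kept only as a deprecated alias — the use below is
rewired to Mathlib. [folklore] -/
@[deprecated Matrix.GeneralLinearGroup.continuous_det (since := "2026-08-16")]
alias continuous_generalLinearGroup_det := Matrix.GeneralLinearGroup.continuous_det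

omit [ValuativeRel F] [IsNonarchimedeanLocalField F] in
/-- A character `χ ∘ det` of `GL_n(F)` is smooth (open kernel) when `χ` is. [folklore] -/
theorem isOpen_ker_of_det [IsTopologicalRing F] {n : ℕ} {χ : Fˣ →* ℂˣ}
    (hχ : IsOpen (χ.ker : Set Fˣ)) {c : GL (Fin n) F →* ℂˣ}
    (hc : ∀ g, c g = χ (Matrix.GeneralLinearGroup.det g)) : IsOpen (c.ker : Set (GL (Fin n) F)) := by
  have hset : (c.ker : Set (GL (Fin n) F)) = Matrix.GeneralLinearGroup.det ⁻¹' (χ.ker : Set Fˣ) := by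
    ext g
    simp only [SetLike.mem_coe, MonoidHom.mem_ker, Set.mem_preimage, hc]
  rw [hset]
  exact hχ.preimage Matrix.GeneralLinearGroup.continuous_det

variable [MeasurableSpace F] [BorelSpace F]
  [MeasurableSpace (GL (Fin 1) F ⧸ upperUnitriangular (Fin 1) F)]
  [BorelSpace (GL (Fin 1) F ⧸ upperUnitriangular (Fin 1) F)]

/-- **The vanishing criterion.**  Let `π` be smooth with finite-dimensional Jacquet module, `χ`
a smooth character of `Fˣ` and `c = χ ∘ det`.  If some unit `u₀` with `χ(u₀) ≠ 1` acts
trivially on `V_N` through `d(u₀, 1)`, then (for the invariant measure `ν` of the pole bound)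
every `L`-polynomial `P` of `(π ⊗ χ) × 1` (`HasRSLFactor`) is `1`: the image in the Jacquet module
of the `d(𝒪ˣ, 1)`-fixed vectors of `π ⊗ χ` is `0` (`mk_eq_zero_of_mem_fixedPoints_twist`), so
`deg P ≤ 0` by `natDegree_le_finrank_of_hasRSLFactor`, and `P(0) = 1`.
(Jacquet–Langlands 1970, proof of Prop. 3.8 / Props. 2.9–2.10; Godement 1970, §1.3.)
[cite: JacquetLanglands1970, Props. 2.9–2.10, Prop. 3.8 (i)] -/
theorem hasRSLFactor_twist_eq_one_of_jacquetGL_eq_self (hπ : π.IsSmooth) {ψ : AddChar F Circle}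
    (hψ : ψ.IsContinuousNontrivial)
    [FiniteDimensional ℂ (Representation.restrictUnipotentGL F (id : Fin 2 → Fin 2) π).Coinvariants]
    {χ : Fˣ →* ℂˣ} (hχ : IsOpen (χ.ker : Set Fˣ)) {c : GL (Fin 2) F →* ℂˣ}
    (hc : ∀ g, c g = χ (Matrix.GeneralLinearGroup.det g))
    {u₀ : Fˣ} (hu₀ : valuation F (u₀ : F) = 1) (hχu : χ u₀ ≠ 1)
    (htriv : ∀ x : (Representation.restrictUnipotentGL F (id : Fin 2 → Fin 2) π).Coinvariants,
      Representation.jacquetGL F (id : Fin 2 → Fin 2) π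
        (leviProjection F (id : Fin 2 → Fin 2)
          ⟨diagGL2 u₀ 1, diagGL2_mem_standardParabolicGL_fin_two u₀ 1⟩) x = x) :
    ∃ ν : Measure (GL (Fin 1) F ⧸ upperUnitriangular (Fin 1) F),
      SMulInvariantMeasure (GL (Fin 1) F) (GL (Fin 1) F ⧸ upperUnitriangular (Fin 1) F) ν ∧
      IsFiniteMeasureOnCompacts ν ∧ ν.IsOpenPosMeasure ∧
      ∀ P : ℂ[X], HasRSLFactor Nat.one_lt_two (π.twist c)
        (Representation.trivial ℂ (GL (Fin 1) F) ℂ) ψ ν P → P = 1 := by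
  haveI : T2Space F :=
    (Literature.NumberTheory.GaloisRepresentations.IsNonarchimedeanLocalField.isLocalField F).toT2Space
  obtain ⟨H, hH⟩ := exists_subgroup_diagGL2_units (F := F)
  have hπ' : (π.twist c).IsSmooth := hπ.twist (isOpen_ker_of_det hχ hc)
  haveI : FiniteDimensional ℂ
      (Representation.restrictUnipotentGL F (id : Fin 2 → Fin 2) (π.twist c)).Coinvariants := by
    rw [restrictUnipotentGL_twist_det π χ c hc]
    infer_instance
  obtain ⟨ν, hinv, hfin, hpos, hC⟩ := natDegree_le_finrank_of_hasRSLFactor (π.twist c) hπ' hψ H hH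
  refine ⟨ν, hinv, hfin, hpos, fun P hP => ?_⟩
  have hbot : Submodule.map (Representation.Coinvariants.mk
      (Representation.restrictUnipotentGL F (id : Fin 2 → Fin 2) (π.twist c)))
      ((π.twist c).fixedPoints H) = ⊥ := by
    rw [eq_bot_iff]
    rintro _ ⟨v, hv, rfl⟩
    rw [Submodule.mem_bot]
    exact mk_eq_zero_of_mem_fixedPoints_twist π hc H hH hu₀ hχu htriv hv
  have h := hC P hP
  rw [hbot, finrank_bot, Nat.le_zero] at h
  have hP0 : P.eval 0 = 1 := hP.1
  rw [Polynomial.eq_C_of_natDegree_eq_zero h, Polynomial.eval_C] at hP0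
  rw [Polynomial.eq_C_of_natDegree_eq_zero h, hP0, map_one]

end Criterion

/-! ### Part 3: deep twists (Jacquet–Langlands 1970, Prop. 3.8 (i)) -/

section Deep

variable {F : Type*} [Field F] [ValuativeRel F] [TopologicalSpace F] [IsNonarchimedeanLocalField F]
  {V : Type*} [AddCommGroup V] [Module ℂ V] (π : Representation ℂ (GL (Fin 2) F) V)

/-- **A deep enough unit group acts trivially on a finite-dimensional Jacquet module.**  For `π`
smooth with `V_N` finite-dimensional there is `N ≥ 1` such that `d(u, 1)` acts trivially on `V_N`
for all `u ∈ U^N = 1 + 𝔭^N`: lift a basis of `V_N` to `V`, intersect the (open) stabilisers, and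
pull back along the continuous `u ↦ d(u, 1)`; the unit filtration is a neighbourhood basis of
`1` in `Fˣ`. (Jacquet–Langlands 1970, proof of Prop. 3.8; Godement 1970, §1.3.) [folklore] -/
theorem exists_unitFiltration_forall_jacquetGL_diagGL2_eq_self (hπ : π.IsSmooth)
    [FiniteDimensional ℂ (Representation.restrictUnipotentGL F (id : Fin 2 → Fin 2) π).Coinvariants] :
    ∃ N : ℕ, 1 ≤ N ∧ ∀ u ∈ unitFiltration F N,
      ∀ x : (Representation.restrictUnipotentGL F (id : Fin 2 → Fin 2) π).Coinvariants,
        Representation.jacquetGL F (id : Fin 2 → Fin 2) π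
          (leviProjection F (id : Fin 2 → Fin 2)
            ⟨diagGL2 u 1, diagGL2_mem_standardParabolicGL_fin_two u 1⟩) x = x := by
  classical
  set J := Representation.Coinvariants.mk (Representation.restrictUnipotentGL F (id : Fin 2 → Fin 2) π)
    with hJ
  let b := Module.finBasis ℂ (Representation.restrictUnipotentGL F (id : Fin 2 → Fin 2) π).Coinvariants
  have hlift : ∀ i, ∃ v : V, J v = b i := fun i =>
    Representation.Coinvariants.mk_surjective _ (b i)
  choose v hv using hlift
  -- the open set `S = ⋂ᵢ Stab(vᵢ)` and its pull-back to `Fˣ`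
  set S : Set (GL (Fin 2) F) := ⋂ i, (π.stabilizerSubgroup (v i) : Set (GL (Fin 2) F)) with hS_def
  have hS : IsOpen S := isOpen_iInter_of_finite fun i => hπ (v i)
  have h1S : (1 : GL (Fin 2) F) ∈ S := Set.mem_iInter.2 fun i => (π.stabilizerSubgroup (v i)).one_mem
  have hpre : (fun a : Fˣ => (diagGL2 a 1 : GL (Fin 2) F)) ⁻¹' S ∈ nhds (1 : Fˣ) := by
    refine (continuous_unitsDiagGL2_one (F := F)).continuousAt.preimage_mem_nhds ?_
    have h1 : S ∈ nhds ((fun a : Fˣ => (diagGL2 a 1 : GL (Fin 2) F)) 1) := by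
      simp only [diagGL2_one]
      exact hS.mem_nhds h1S
    exact h1
  obtain ⟨N, hN1, hN⟩ := exists_unitFiltration_subset hpre
  refine ⟨N, hN1, fun u hu => ?_⟩
  have huS : (diagGL2 u 1 : GL (Fin 2) F) ∈ S := hN hu
  have hfix : ∀ i, π (diagGL2 u 1) (v i) = v i := fun i =>
    (π.mem_stabilizerSubgroup (v i) _).1 (Set.mem_iInter.1 huS i)
  have hb : ∀ i, Representation.jacquetGL F (id : Fin 2 → Fin 2) π
      (leviProjection F (id : Fin 2 → Fin 2)
        ⟨diagGL2 u 1, diagGL2_mem_standardParabolicGL_fin_two u 1⟩) (b i) = b i := fun i => by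
    rw [← hv i, jacquetGL_leviProjection_diagGL2_mk, hfix i]
  have heq : (Representation.jacquetGL F (id : Fin 2 → Fin 2) π
      (leviProjection F (id : Fin 2 → Fin 2)
        ⟨diagGL2 u 1, diagGL2_mem_standardParabolicGL_fin_two u 1⟩) :
        (Representation.restrictUnipotentGL F (id : Fin 2 → Fin 2) π).Coinvariants →ₗ[ℂ]
          (Representation.restrictUnipotentGL F (id : Fin 2 → Fin 2) π).Coinvariants) = LinearMap.id :=
    b.ext fun i => by rw [hb i, LinearMap.id_apply]
  intro x
  exact LinearMap.congr_fun heq x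

variable [MeasurableSpace F] [BorelSpace F]
  [MeasurableSpace (GL (Fin 1) F ⧸ upperUnitriangular (Fin 1) F)]
  [BorelSpace (GL (Fin 1) F ⧸ upperUnitriangular (Fin 1) F)]

/-- **Deep twists kill the `L`-factor** (Jacquet–Langlands 1970, Prop. 3.8 (i), first identity:
"if the order of `χ` is large enough, `L(s, χ ⊗ π) = 1`"; "order" = conductor exponent, p. 33).
Let `π` be a smooth representation of `GL₂(F)` with finite-dimensional Jacquet module and `ψ`
continuous non-trivial.  There is `N ≥ 1` such that for every smooth character `χ` of `Fˣ` which
is non-trivial on `U^N = 1 + 𝔭^N` (conductor exponent `> N`) and `c = χ ∘ det`, every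
`L`-polynomial `P` with `HasRSLFactor (1<2) (π ⊗ c) 1 ψ ν P` (for the invariant measure `ν` on
`GL₁(F) ⧸ U₁` produced by the pole bound) is `P = 1`, i.e. `L(s, (π ⊗ χ) × 1) = 1`.
[cite: JacquetLanglands1970, Prop. 3.8 (i)] -/
theorem exists_unitFiltration_forall_hasRSLFactor_twist_eq_one (hπ : π.IsSmooth)
    {ψ : AddChar F Circle} (hψ : ψ.IsContinuousNontrivial)
    [FiniteDimensional ℂ (Representation.restrictUnipotentGL F (id : Fin 2 → Fin 2) π).Coinvariants] :
    ∃ N : ℕ, 1 ≤ N ∧ ∀ (χ : Fˣ →* ℂˣ), IsOpen (χ.ker : Set Fˣ) →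
      (∃ u ∈ unitFiltration F N, χ u ≠ 1) →
      ∀ (c : GL (Fin 2) F →* ℂˣ), (∀ g, c g = χ (Matrix.GeneralLinearGroup.det g)) →
      ∃ ν : Measure (GL (Fin 1) F ⧸ upperUnitriangular (Fin 1) F),
        SMulInvariantMeasure (GL (Fin 1) F) (GL (Fin 1) F ⧸ upperUnitriangular (Fin 1) F) ν ∧
        IsFiniteMeasureOnCompacts ν ∧ ν.IsOpenPosMeasure ∧
        ∀ P : ℂ[X], HasRSLFactor Nat.one_lt_two (π.twist c)
          (Representation.trivial ℂ (GL (Fin 1) F) ℂ) ψ ν P → P = 1 := by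
  obtain ⟨N, hN1, hN⟩ := exists_unitFiltration_forall_jacquetGL_diagGL2_eq_self π hπ
  refine ⟨N, hN1, fun χ hχ ⟨u₀, hu₀, hχu⟩ c hc => ?_⟩
  have hu₀' : valuation F (u₀ : F) = 1 := (normAbs_eq_one_iff_valuation_eq_one (F := F)).1 hu₀.1
  exact hasRSLFactor_twist_eq_one_of_jacquetGL_eq_self π hπ hψ hχ hc hu₀' hχu (hN u₀ hu₀)

end Deep

/-! ### Part 4: ramified twists of spherical representations (Jacquet–Langlands 1970, Prop. 3.5) -/

section Spherical

variable {F : Type*} [Field F] [ValuativeRel F] [TopologicalSpace F] [IsNonarchimedeanLocalField F]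
  {V : Type*} [AddCommGroup V] [Module ℂ V] (π : Representation ℂ (GL (Fin 2) F) V)

omit [TopologicalSpace F] [IsNonarchimedeanLocalField F] in
/-- **For a spherical irreducible representation, all of `d(𝒪ˣ, 1)` acts trivially on the
Jacquet module.**  If `π` is irreducible with a non-zero `GL₂(𝒪)`-fixed vector `v₀`, then
`V = span {π(g) v₀}`; writing `g = b k` (Iwasawa, `exists_borel_mul_glInt`) the class of
`π(g) v₀ = π(b) v₀` in `V_N` is `proj(b) · [v₀]`, and the torus of `GL₂` is commutative while
`d(u, 1) ∈ GL₂(𝒪)` fixes `v₀`; so `d(u, 1)` fixes a spanning set of `V_N`.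
(Jacquet–Langlands 1970, Prop. 3.5 with Lemma 3.9; Bump 1997, §4.6.) [folklore] -/
theorem jacquetGL_diagGL2_eq_self_of_spherical [π.IsIrreducible] {v₀ : V} (hv₀ : v₀ ≠ 0)
    (hK : v₀ ∈ π.fixedPoints (glInt 2 F)) {u : Fˣ} (hu : valuation F (u : F) = 1)
    (x : (Representation.restrictUnipotentGL F (id : Fin 2 → Fin 2) π).Coinvariants) :
    Representation.jacquetGL F (id : Fin 2 → Fin 2) π
      (leviProjection F (id : Fin 2 → Fin 2)
        ⟨diagGL2 u 1, diagGL2_mem_standardParabolicGL_fin_two u 1⟩) x = x := by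
  set T := Representation.jacquetGL F (id : Fin 2 → Fin 2) π
      (leviProjection F (id : Fin 2 → Fin 2)
        ⟨diagGL2 u 1, diagGL2_mem_standardParabolicGL_fin_two u 1⟩) with hT
  set J := Representation.Coinvariants.mk (Representation.restrictUnipotentGL F (id : Fin 2 → Fin 2) π)
    with hJ
  have hdv : π (diagGL2 u 1) v₀ = v₀ :=
    (π.mem_fixedPoints _ v₀).1 hK _ (diagGL2_mem_glInt hu (by rw [Units.val_one, map_one]))
  -- `T` fixes the class of every `π(g) v₀`
  have hfixg : ∀ g : GL (Fin 2) F, T (J (π g v₀)) = J (π g v₀) := by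
    intro g
    obtain ⟨b, hb, k, hk, rfl⟩ := exists_borel_mul_glInt g
    have hkv : π k v₀ = v₀ := (π.mem_fixedPoints _ v₀).1 hK k hk
    rw [map_mul, Module.End.mul_apply, hkv]
    have hbv : J (π b v₀) = Representation.jacquetGL F (id : Fin 2 → Fin 2) π
        (leviProjection F (id : Fin 2 → Fin 2) ⟨b, hb⟩) (J v₀) := by
      rw [hJ, jacquetGL_leviProjection_mk]
    rw [hbv, hT, ← Module.End.mul_apply, ← map_mul, levi_fin_two_mul_comm, map_mul,
      Module.End.mul_apply, jacquetGL_leviProjection_diagGL2_mk, hdv]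
  -- the orbit of `v₀` spans `V`, and `J` is onto
  have hspan := Representation.IsIrreducible.span_orbit_eq_top π hv₀
  obtain ⟨w, rfl⟩ := Representation.Coinvariants.mk_surjective
    (Representation.restrictUnipotentGL F (id : Fin 2 → Fin 2) π) x
  have hw : w ∈ Submodule.span ℂ (Set.range fun g : GL (Fin 2) F => π g v₀) := by
    rw [hspan]; trivial
  refine Submodule.span_induction ?_ ?_ ?_ ?_ hw
  · rintro _ ⟨g, rfl⟩
    exact hfixg g
  · rw [map_zero, map_zero]
  · intro a a' _ _ ha ha'
    rw [map_add, map_add, ha, ha']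
  · intro r a _ ha
    rw [map_smul, map_smul, ha]

variable [MeasurableSpace F] [BorelSpace F]
  [MeasurableSpace (GL (Fin 1) F ⧸ upperUnitriangular (Fin 1) F)]
  [BorelSpace (GL (Fin 1) F ⧸ upperUnitriangular (Fin 1) F)]

/-- **A ramified twist of a spherical representation has `L`-factor `1`** (Jacquet–Langlands
1970, Prop. 3.5: for `π = π(μ₁, μ₂)` with `μᵢ` unramified and `χ` ramified,
`L(s, χ ⊗ π) = L(s, χμ₁) L(s, χμ₂) = 1`; the one-dimensional `π(μ₁, μ₂)`, Prop. 3.6 / Lemma 3.9,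
are covered as well).  Hypotheses: `π` smooth irreducible with finite-dimensional Jacquet module
and a non-zero `GL₂(𝒪)`-fixed vector, `χ` a smooth character of `Fˣ` non-trivial on `𝒪ˣ`,
`c = χ ∘ det`.  Conclusion: every `L`-polynomial of `(π ⊗ χ) × 1` for the invariant measure of
the pole bound is `1`. [cite: JacquetLanglands1970, Prop. 3.5, Prop. 3.6] -/
theorem hasRSLFactor_twist_eq_one_of_spherical [π.IsIrreducible] (hπ : π.IsSmooth)
    {ψ : AddChar F Circle} (hψ : ψ.IsContinuousNontrivial)
    [FiniteDimensional ℂ (Representation.restrictUnipotentGL F (id : Fin 2 → Fin 2) π).Coinvariants]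
    (hsph : ∃ v₀ : V, v₀ ≠ 0 ∧ v₀ ∈ π.fixedPoints (glInt 2 F))
    {χ : Fˣ →* ℂˣ} (hχ : IsOpen (χ.ker : Set Fˣ))
    (hram : ∃ u : Fˣ, valuation F (u : F) = 1 ∧ χ u ≠ 1)
    {c : GL (Fin 2) F →* ℂˣ} (hc : ∀ g, c g = χ (Matrix.GeneralLinearGroup.det g)) :
    ∃ ν : Measure (GL (Fin 1) F ⧸ upperUnitriangular (Fin 1) F),
      SMulInvariantMeasure (GL (Fin 1) F) (GL (Fin 1) F ⧸ upperUnitriangular (Fin 1) F) ν ∧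
      IsFiniteMeasureOnCompacts ν ∧ ν.IsOpenPosMeasure ∧
      ∀ P : ℂ[X], HasRSLFactor Nat.one_lt_two (π.twist c)
        (Representation.trivial ℂ (GL (Fin 1) F) ℂ) ψ ν P → P = 1 := by
  obtain ⟨v₀, hv₀, hK⟩ := hsph
  obtain ⟨u₀, hu₀, hχu⟩ := hram
  exact hasRSLFactor_twist_eq_one_of_jacquetGL_eq_self π hπ hψ hχ hc hu₀ hχu
    (jacquetGL_diagGL2_eq_self_of_spherical π hv₀ hK hu₀)

end Spherical

/-! ### Part 5: the Jacquet module of an irreducible smooth representation of `GL₂(F)` has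
dimension `≤ 2`; `deg L(s, π × 1)⁻¹ ≤ 2` -/

section Degree

variable {F : Type*} [Field F] [ValuativeRel F] [TopologicalSpace F] [IsNonarchimedeanLocalField F]

set_option maxHeartbeats 1600000 in
/-- **The Jacquet module of an irreducible smooth representation of `GL₂(F)` is finite-dimensional
of dimension `≤ 2`** (Jacquet–Langlands 1970, Props. 2.9–2.10 with §3; Bernstein–Zelevinsky 1977,
§2–3).  Classification-free: either `V_N = 0`, or an irreducible quotient `σ₀` of the smooth
`T`-module `V_N` is a character (Schur), Frobenius reciprocity embeds `π ↪ I(σ)` and the exact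
Jacquet functor embeds `V_N ↪ I(σ)_N`, which has dimension `≤ 2` (Steps A–B of
`exists_mem_fixedPoints_glInt_of_hasRSLFactor_natDegree_two`).
[cite: JacquetLanglands1970, Props. 2.9–2.10] [cite: BernsteinZelevinskyASENS1977, §2] -/
theorem finiteDimensional_coinvariants_smoothIrrep_fin_two (πv : SmoothIrrep (GL (Fin 2) F)) :
    FiniteDimensional ℂ (Representation.restrictUnipotentGL F (id : Fin 2 → Fin 2) πv.ρ).Coinvariants ∧
      Module.finrank ℂ (Representation.restrictUnipotentGL F (id : Fin 2 → Fin 2) πv.ρ).Coinvariants ≤ 2 := by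
  classical
  haveI := πv.isIrreducible
  have hπ : πv.ρ.IsSmooth := πv.isSmooth
  rcases subsingleton_or_nontrivial
    (Representation.restrictUnipotentGL F (id : Fin 2 → Fin 2) πv.ρ).Coinvariants with hVN | hVN
  · haveI := hVN
    exact ⟨Module.Finite.of_finite, by rw [Module.finrank_zero_of_subsingleton]; exact Nat.zero_le _⟩
  haveI := hVN
  -- Step A: an irreducible quotient `σ₀` of the `T`-module `V_N` (a character) and `π ↪ I(σ)`
  obtain ⟨N₀, hN₀⟩ := Representation.exists_isCoatom_subrepresentation_jacquetGL F (id : Fin 2 → Fin 2) πv.ρ hπ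
  haveI hσ₀irr : N₀.quotientRep.IsIrreducible := Subrepresentation.isIrreducible_quotientRep hN₀
  have hσ₀s : N₀.quotientRep.IsSmooth :=
    (Representation.IsSmooth.jacquetGL F (id : Fin 2 → Fin 2) hπ).quotientRep N₀
  have hq0 : N₀.mkQ ≠ 0 := by
    intro h
    apply hN₀.1
    refine eq_top_iff.2 fun x _ => (N₀.mkQ_eq_zero_iff x).1 ?_
    rw [h]
    rfl
  obtain ⟨σ, hσ_def⟩ : ∃ σ : Representation ℂ (Π a, GL {i // (id : Fin 2 → Fin 2) i = a} F)
      ((Representation.restrictUnipotentGL F (id : Fin 2 → Fin 2) πv.ρ).Coinvariants ⧸ N₀.toSubmodule),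
      σ = N₀.quotientRep.twist ((rootDeltaChar (standardParabolicGL F (id : Fin 2 → Fin 2))).comp
        (leviEmbeddingP F (id : Fin 2 → Fin 2)))⁻¹ := ⟨_, rfl⟩
  have hσs : σ.IsSmooth := by
    rw [hσ_def]
    exact Representation.IsSmooth.twist_rootDeltaChar_inv F (id : Fin 2 → Fin 2) hσ₀s
  have hsc₀ := exists_apply_eq_smul_of_isIrreducible_levi_fin_two N₀.quotientRep hσ₀s
  obtain ⟨hWfd, hW1⟩ := finrank_eq_one_of_isIrreducible_of_smul N₀.quotientRep hsc₀
  haveI := hWfd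
  -- Step B: `dim I(σ)_N ≤ 2`, the embedding `π ↪ I(σ)`, `dim V_N ≤ 2`
  obtain ⟨hJfd, hJle⟩ := finiteDimensional_coinvariants_parabolicIndGL_fin_two σ hσs
  have hJle2 : Module.finrank ℂ (Representation.restrictUnipotentGL F (id : Fin 2 → Fin 2)
      (Representation.parabolicIndGL F (id : Fin 2 → Fin 2) σ)).Coinvariants ≤ 2 :=
    hJle.trans (by rw [hW1])
  haveI := hJfd
  have hIs : (Representation.parabolicIndGL F (id : Fin 2 → Fin 2) σ).IsSmooth :=
    Representation.isSmooth_smoothInd _ _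
  obtain ⟨f, hf⟩ : ∃ f : πv.ρ.IntertwiningMap (Representation.parabolicIndGL F (id : Fin 2 → Fin 2) σ),
      Function.Injective f := by
    rw [hσ_def]
    exact Representation.exists_injective_intertwiningMap_parabolicIndGL F (id : Fin 2 → Fin 2)
      πv.ρ hπ N₀.quotientRep N₀.mkQ hq0
  have hinj : Function.Injective (jacquetGLMap F (id : Fin 2 → Fin 2) f).toLinearMap :=
    jacquetGLMap_injective monotone_id hIs f hf
  haveI hVfd : FiniteDimensional ℂ
      (Representation.restrictUnipotentGL F (id : Fin 2 → Fin 2) πv.ρ).Coinvariants :=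
    Module.Finite.of_injective (jacquetGLMap F (id : Fin 2 → Fin 2) f).toLinearMap hinj
  exact ⟨hVfd, (LinearMap.finrank_le_finrank_of_injective hinj).trans hJle2⟩

variable [MeasurableSpace F] [BorelSpace F]
  [MeasurableSpace (GL (Fin 1) F ⧸ upperUnitriangular (Fin 1) F)]
  [BorelSpace (GL (Fin 1) F ⧸ upperUnitriangular (Fin 1) F)]

/-- **`deg L(s, π × 1)⁻¹ ≤ 2` for every irreducible smooth representation of `GL₂(F)`**
(Jacquet–Langlands 1970, Thm. 2.18 with Props. 3.5, 3.6 and p. 40: the Euler factor of an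
irreducible admissible `π` is `1`, `(1 - αq^{-s})⁻¹` or `(1 - αq^{-s})⁻¹(1 - βq^{-s})⁻¹`), for
the invariant measure `ν` of the pole bound: `deg P ≤ dim M ≤ dim V_N ≤ 2`.
[cite: JacquetLanglands1970, Thm. 2.18, Props. 3.5–3.6] -/
theorem natDegree_le_two_of_hasRSLFactor (πv : SmoothIrrep (GL (Fin 2) F)) {ψ : AddChar F Circle}
    (hψ : ψ.IsContinuousNontrivial) :
    ∃ ν : Measure (GL (Fin 1) F ⧸ upperUnitriangular (Fin 1) F),
      SMulInvariantMeasure (GL (Fin 1) F) (GL (Fin 1) F ⧸ upperUnitriangular (Fin 1) F) ν ∧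
      IsFiniteMeasureOnCompacts ν ∧ ν.IsOpenPosMeasure ∧
      ∀ P : ℂ[X], HasRSLFactor Nat.one_lt_two πv.ρ
        (Representation.trivial ℂ (GL (Fin 1) F) ℂ) ψ ν P → P.natDegree ≤ 2 := by
  obtain ⟨hfd, hle⟩ := finiteDimensional_coinvariants_smoothIrrep_fin_two πv
  haveI := hfd
  obtain ⟨H, hH⟩ := exists_subgroup_diagGL2_units (F := F)
  obtain ⟨ν, hinv, hfin, hpos, hC⟩ := natDegree_le_finrank_of_hasRSLFactor πv.ρ πv.isSmooth hψ H hH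
  refine ⟨ν, hinv, hfin, hpos, fun P hP => ((hC P hP).trans (Submodule.finrank_le _)).trans hle⟩

/-- **Deep twists kill the `L`-factor of an irreducible smooth representation of `GL₂(F)`**
(Jacquet–Langlands 1970, Prop. 3.8 (i), bundled form): for `π` irreducible smooth and `ψ`
continuous non-trivial there is `N ≥ 1` such that `L(s, (π ⊗ χ) × 1) = 1` (every `L`-polynomial
is `1`, for the invariant measure of the pole bound) for every smooth `χ` non-trivial on
`U^N = 1 + 𝔭^N`. [cite: JacquetLanglands1970, Prop. 3.8 (i)] -/
theorem exists_unitFiltration_forall_hasRSLFactor_twist_eq_one_smoothIrrep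
    (πv : SmoothIrrep (GL (Fin 2) F)) {ψ : AddChar F Circle} (hψ : ψ.IsContinuousNontrivial) :
    ∃ N : ℕ, 1 ≤ N ∧ ∀ (χ : Fˣ →* ℂˣ), IsOpen (χ.ker : Set Fˣ) →
      (∃ u ∈ unitFiltration F N, χ u ≠ 1) →
      ∀ (c : GL (Fin 2) F →* ℂˣ), (∀ g, c g = χ (Matrix.GeneralLinearGroup.det g)) →
      ∃ ν : Measure (GL (Fin 1) F ⧸ upperUnitriangular (Fin 1) F),
        SMulInvariantMeasure (GL (Fin 1) F) (GL (Fin 1) F ⧸ upperUnitriangular (Fin 1) F) ν ∧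
        IsFiniteMeasureOnCompacts ν ∧ ν.IsOpenPosMeasure ∧
        ∀ P : ℂ[X], HasRSLFactor Nat.one_lt_two (πv.ρ.twist c)
          (Representation.trivial ℂ (GL (Fin 1) F) ℂ) ψ ν P → P = 1 := by
  haveI := (finiteDimensional_coinvariants_smoothIrrep_fin_two πv).1
  exact exists_unitFiltration_forall_hasRSLFactor_twist_eq_one πv.ρ πv.isSmooth hψ

/-- **A ramified twist of a spherical irreducible representation of `GL₂(F)` has trivial
`L`-factor** (Jacquet–Langlands 1970, Props. 3.5–3.6, bundled form): `π` irreducible smooth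
with a non-zero `GL₂(𝒪)`-fixed vector, `χ` smooth and non-trivial on `𝒪ˣ`, `c = χ ∘ det`; then
`L(s, (π ⊗ χ) × 1) = 1`. [cite: JacquetLanglands1970, Prop. 3.5, Prop. 3.6] -/
theorem hasRSLFactor_twist_eq_one_of_spherical_smoothIrrep (πv : SmoothIrrep (GL (Fin 2) F))
    {ψ : AddChar F Circle} (hψ : ψ.IsContinuousNontrivial)
    (hsph : ∃ v₀ : πv.V, v₀ ≠ 0 ∧ v₀ ∈ πv.ρ.fixedPoints (glInt 2 F))
    {χ : Fˣ →* ℂˣ} (hχ : IsOpen (χ.ker : Set Fˣ))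
    (hram : ∃ u : Fˣ, valuation F (u : F) = 1 ∧ χ u ≠ 1)
    {c : GL (Fin 2) F →* ℂˣ} (hc : ∀ g, c g = χ (Matrix.GeneralLinearGroup.det g)) :
    ∃ ν : Measure (GL (Fin 1) F ⧸ upperUnitriangular (Fin 1) F),
      SMulInvariantMeasure (GL (Fin 1) F) (GL (Fin 1) F ⧸ upperUnitriangular (Fin 1) F) ν ∧
      IsFiniteMeasureOnCompacts ν ∧ ν.IsOpenPosMeasure ∧
      ∀ P : ℂ[X], HasRSLFactor Nat.one_lt_two (πv.ρ.twist c)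
        (Representation.trivial ℂ (GL (Fin 1) F) ℂ) ψ ν P → P = 1 := by
  haveI := πv.isIrreducible
  haveI := (finiteDimensional_coinvariants_smoothIrrep_fin_two πv).1
  exact hasRSLFactor_twist_eq_one_of_spherical πv.ρ πv.isSmooth hψ hsph hχ hram hc

end Degree

end Literature.NumberTheory.Automorphic

end
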